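import Summits.CriticalPhenomena.SAWScalingLimit.Theorems.SAWTotalPositivityTPToTraversalBoundCleanContractionAux

/-!
# Decoration removal for `TPToTraversalBound` — helper file (residual statement and reductions)

Crux `SAWTotalPositivity.TPToTraversalBound` (stmt-CriticalPhenomena-10687), line `radial-portal-transfer`,
stub `stub_decorationRemoval : BoundaryTP2 → CriticalBubbleBound → CleanContraction → HeavinessContraction`
(the G2 core of the line: from undecorated to arbitrarily decorated outside data of a clean box).

`HeavinessContraction` is `CleanContraction` with the hypothesis on the conditioning walk `γ₀` weakened
from "at most `m` maximal pieces outside the open box `B_∞(c, 4N)` IN TOTAL"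
(`¬ HasPieces γ₀ c (4N) 0 (m+1)`) to "at most `m` BIG ones, sup-diameter `≥ 2N`"
(`¬ HasPieces γ₀ c (4N) (4N) (m+1)`): any number of small outside pieces (decorations) is free and
must not move the constants `θ, λ₀, C, m₀`.  This file proves the honest, sorry-free part:

* `HeavinessContractionCore` — the RESIDUAL statement: `HeavinessContraction` restricted to the only
  non-trivial regime, exactly as `CleanContractionCore` restricts `CleanContraction` (`N ≥ N₀` for an
  `N₀` of the prover's choice and `N ≥ 2`, `u ≠ v`, `θ m + m₀ ≤ j ≤ min((2N-1)² + 1, 8N + 1)`,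
  `m ≤ 2j`; the decorated hypothesis is kept), and the reduction
  `heavinessContraction_of_core : HeavinessContractionCore → HeavinessContraction` (the trivial
  regimes `j > (2N-1)² + 1`, `j > 8N + 1`, `u = v`, `N ≤ 1`, `N < N₀` are empty events by the landed
  lemmas `law_sep_hasPieces_eq_zero`, `law_sep_hasPieces_eq_zero'`, `law_sep_hasPieces_eq_zero_of_loop`
  of `…CleanContractionAux`; `θ ↦ max θ (1/2)`, `m₀ ↦ max m₀ (8N₀ + 3)`);
* the sanity direction `cleanContraction_of_heavinessContraction : HeavinessContraction → CleanContraction`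
  (fewer pieces in total means fewer big pieces, `HasPieces.mono_d`) and its core version;
* `HeavinessContractionFree` — the THRESHOLD-FREE form (`θ = 0`: no hypothesis at all on the outside
  configuration, threshold `j ≥ m₀`), with `heavinessContraction_of_free : HeavinessContractionFree →
  HeavinessContraction` and `heavinessContractionFree_of_clean_nonpos`: the clean kernel inequality with
  ANY slope `θ ≤ 0` already gives the free form, hence `HeavinessContraction`.  In words: decoration
  removal is only an issue because the planner let the threshold grow with the number `m` of conditioned
  pieces; a clean kernel contraction with an `m`-independent threshold (which the wave-2 census suggests:
  on every atom the typical inner heaviness is `O(1)`, crossing bundles being outweighed by shallow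
  re-pairings) removes decorations for free;
* `HeavinessContractionFreeCore` — the residual of the free form (`N ≥ N₀`, `N ≥ 2`, `u ≠ v`,
  `m₀ ≤ j ≤ min((2N-1)² + 1, 8N + 1)`), with `heavinessContractionFree_of_freeCore` and
  `heavinessContractionCore_of_freeCore`: the simplest single target implying every contraction
  statement of the line (an option for the lead: one engine stub instead of clean kernel + decoration
  removal);
* `not_hasPieces_outer` — a-priori, an outside configuration of the box `B_∞(c, 4N)` has at most
  `32N + 1` maximal pieces, so "arbitrarily decorated" means `s ≤ 32N + 1 - m` decorations;
* `heavinessContraction_bdd_of_clean` — what `CleanContraction` does give on decorated data: the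
  inequality with the `s`-dependent threshold `θ m + (m₀ + s)` for data with `s` decorations; the stub is
  precisely the uniformity in `s ≍ N`.
-/

noncomputable section

open MeasureTheory Filter Topology Set Metric
open scoped NNReal ENNReal
open Literature.Probability.LatticeModels
open Literature.Probability.RandomPlanarGeometry
open Literature.Probability.RandomPlanarGeometry.SAW
open Summit.CriticalPhenomena.SAWScalingLimit.Theses.SAWTotalPositivity

namespace Summit.CriticalPhenomena.SAWScalingLimit.Theorems.TPToTraversalBound.Radial

variable {Ω : Set ℂ} {δ : ℝ} {u v : Site 2}

/-! ## Decorated data: elementary remarks -/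

/-- **At most `32N + 1` outside pieces.** An outside configuration of the box `B_∞(c, 4N)` has at
most `8 · 4N + 1` maximal pieces of any diameter (`HasPieces.le_eight_mul_succ`): a decorated datum
with `m` big pieces carries at most `32N + 1 - m` decorations. [folklore] -/
theorem not_hasPieces_outer (γ : DomainSAW Ω δ u v) (c : Site 2) (N d : ℕ) :
    ¬ HasPieces γ c (4 * N) d (32 * N + 2) := by
  intro h
  have := h.le_eight_mul_succ
  omega

/-! ## The residual statement and the reduction -/

/-- **Residual heaviness contraction** (the non-trivial regime of `HeavinessContraction`, same
objects). As `HeavinessContraction` — the conditioning walk `γ₀` has at most `m` BIG maximal pieces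
(sup-diameter `≥ 2N`) outside the open box `B_∞(c, 4N)` and any number of small ones — but only
asymptotically in the box size (`N ≥ N₀` for an `N₀` of the prover's choice, and `N ≥ 2`), with
distinct endpoints `u ≠ v`, targets `j ≤ min((2N-1)² + 1, 8N + 1)` (otherwise the heaviness event
is empty) and `m ≤ 2j` (a free normalisation: any admissible `θ` may be enlarged to `max θ (1/2)`).
By `heavinessContraction_of_core` this statement implies `HeavinessContraction`; it is the
decorated multi-strand crossing estimate for critical square-lattice SAW in the clean ratio-4 square
annulus: given the outside configuration `E₀ = outEdgeSet γ₀ c (4N)` (big pieces AND decorations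
pinned, inner pairing free among the admissible ones), `≥ j` big pieces outside the inner box should
cost `C 2^{-λ j}` as soon as `j ≥ θ m + m₀`, uniformly in the decorations. Nothing is asserted
here. -/
def HeavinessContractionCore : Prop :=
  ∃ (N₀ : ℕ) (θ lam C : ℝ) (m₀ : ℕ), θ < 1 ∧ 0 < lam ∧
    ∀ (Ω : Set ℂ) (δ : ℝ) (u v c : Site 2) (N m j : ℕ) (γ₀ : DomainSAW Ω δ u v),
      Bornology.IsBounded Ω → 0 < δ → N₀ ≤ N → 2 ≤ N → closedBox δ c (4 * N) ⊆ Ω → u ≠ v →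
      ¬ HasPieces γ₀ c (4 * N) (4 * N) (m + 1) → θ * m + m₀ ≤ (j : ℝ) →
      j ≤ (2 * N - 1) ^ 2 + 1 → j ≤ 8 * N + 1 → m ≤ 2 * j →
      law Ω δ u v {γ | outEdgeSet γ c (4 * N) = outEdgeSet γ₀ c (4 * N) ∧ HasPieces γ c N N j}
        ≤ ENNReal.ofReal (C * 2 ^ (-(lam * j))) *
          law Ω δ u v {γ | outEdgeSet γ c (4 * N) = outEdgeSet γ₀ c (4 * N)}

/-- **Reduction: the residual statement implies `HeavinessContraction`.** With
`θ' = max θ (1/2) < 1` and `m₀' = max m₀ (8N₀ + 3)` every admissible target satisfies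
`j ≥ 8N₀ + 3 ≥ 3` and `m ≤ 2j`; if `j > (2N-1)² + 1` or `j > 8N + 1` (in particular whenever
`N < N₀ + 1`) the event is empty (`law_sep_hasPieces_eq_zero`, `law_sep_hasPieces_eq_zero'`); if
`u = v` the only SAW is trivial and the event is empty for `j ≥ 2`; `N ≤ 1` forces
`j ≤ (2N-1)² + 1 ≤ 2 < 3`; the remaining data are exactly those of `HeavinessContractionCore`
(the decorated hypothesis is passed through unchanged). Proof adapted from
`cleanContraction_of_core` (`…CleanContractionAux`, same line). [folklore] -/
theorem heavinessContraction_of_core : HeavinessContractionCore → HeavinessContraction := by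
  -- adapted from cleanContraction_of_core (…CleanContractionAux, same line)
  intro h
  obtain ⟨N₀, θ, lam, C, m₀, hθ, hlam, H⟩ := h
  refine ⟨max θ (1 / 2), lam, C, max m₀ (8 * N₀ + 3), max_lt hθ (by norm_num), hlam, ?_⟩
  intro Ω δ u v c N m j γ₀ hΩ hδ hN hbox hm hj
  have hm0 : (0 : ℝ) ≤ m := Nat.cast_nonneg _
  have hθ' : (1 / 2 : ℝ) * m ≤ max θ (1 / 2) * m :=
    mul_le_mul_of_nonneg_right (le_max_right _ _) hm0
  have hm₀' : ((8 * N₀ + 3 : ℕ) : ℝ) ≤ ((max m₀ (8 * N₀ + 3) : ℕ) : ℝ) := by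
    exact_mod_cast le_max_right m₀ _
  have hm₀ : (m₀ : ℝ) ≤ ((max m₀ (8 * N₀ + 3) : ℕ) : ℝ) := by exact_mod_cast le_max_left m₀ _
  have hjN₀ : 8 * N₀ + 3 ≤ j := by
    have : ((8 * N₀ + 3 : ℕ) : ℝ) ≤ j := by nlinarith
    exact_mod_cast this
  have hmj : m ≤ 2 * j := by
    have h8 : (0 : ℝ) ≤ ((8 * N₀ + 3 : ℕ) : ℝ) := Nat.cast_nonneg _
    have : (m : ℝ) ≤ 2 * j := by nlinarith
    exact_mod_cast this
  have hjθ : θ * m + m₀ ≤ (j : ℝ) := by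
    have h1 : θ * m ≤ max θ (1 / 2) * m := mul_le_mul_of_nonneg_right (le_max_left _ _) hm0
    linarith
  by_cases hjN : (2 * N - 1) ^ 2 + 1 < j
  · rw [law_sep_hasPieces_eq_zero _ hjN]
    exact zero_le
  push Not at hjN
  by_cases hjN' : 8 * N + 1 < j
  · rw [law_sep_hasPieces_eq_zero' _ hjN']
    exact zero_le
  push Not at hjN'
  by_cases huv : u = v
  · subst huv
    rw [law_sep_hasPieces_eq_zero_of_loop _ (by omega)]
    exact zero_le
  have hNN₀ : N₀ ≤ N := by omega
  have hN2 : 2 ≤ N := by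
    by_contra hlt
    interval_cases N
    all_goals (norm_num at hjN; omega)
  exact H Ω δ u v c N m j γ₀ hΩ hδ hNN₀ hN2 hbox huv hm hjθ hjN hjN' hmj

/-! ## Sanity: the decorated statements imply the clean ones -/

/-- **`HeavinessContraction → CleanContraction`**: at most `m` pieces in total is at most `m` big
pieces (`HasPieces.mono_d`), so the decorated statement is the stronger one, with the same
constants. [folklore] -/
theorem cleanContraction_of_heavinessContraction : HeavinessContraction → CleanContraction := by
  intro h
  obtain ⟨θ, lam, C, m₀, hθ, hlam, H⟩ := h
  refine ⟨θ, lam, C, m₀, hθ, hlam, ?_⟩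
  intro Ω δ u v c N m j γ₀ hΩ hδ hN hbox hm hj
  exact H Ω δ u v c N m j γ₀ hΩ hδ hN hbox (fun h' => hm (h'.mono_d (Nat.zero_le _))) hj

/-- **`HeavinessContractionCore → CleanContractionCore`** (same remark in the non-trivial regime).
[folklore] -/
theorem cleanContractionCore_of_heavinessContractionCore :
    HeavinessContractionCore → CleanContractionCore := by
  intro h
  obtain ⟨N₀, θ, lam, C, m₀, hθ, hlam, H⟩ := h
  refine ⟨N₀, θ, lam, C, m₀, hθ, hlam, ?_⟩
  intro Ω δ u v c N m j γ₀ hΩ hδ hN₀ hN hbox huv hm hj hj1 hj2 hmj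
  exact H Ω δ u v c N m j γ₀ hΩ hδ hN₀ hN hbox huv (fun h' => hm (h'.mono_d (Nat.zero_le _)))
    hj hj1 hj2 hmj

/-! ## The threshold-free form: decoration removal is automatic at slope `θ ≤ 0` -/

/-- **Threshold-free heaviness contraction** (`θ = 0`). For every outside configuration `γ₀`
whatsoever of a clean box `B_∞(c, 4N)` — no hypothesis on its pieces — the conditional probability
of `≥ j` big pieces outside `B_∞(c, N)` is `≤ C 2^{-λ j}` for all `j ≥ m₀`. This is
`HeavinessContraction` (equivalently `CleanContraction`) with slope `θ = 0`; it implies both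
(`heavinessContraction_of_free`), and it follows from the clean kernel inequality with any slope
`θ ≤ 0` (`heavinessContractionFree_of_clean_nonpos`). Nothing is asserted here. -/
def HeavinessContractionFree : Prop :=
  ∃ (lam C : ℝ) (m₀ : ℕ), 0 < lam ∧
    ∀ (Ω : Set ℂ) (δ : ℝ) (u v c : Site 2) (N j : ℕ) (γ₀ : DomainSAW Ω δ u v),
      Bornology.IsBounded Ω → 0 < δ → 1 ≤ N → closedBox δ c (4 * N) ⊆ Ω → (m₀ : ℝ) ≤ j →
      law Ω δ u v {γ | outEdgeSet γ c (4 * N) = outEdgeSet γ₀ c (4 * N) ∧ HasPieces γ c N N j}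
        ≤ ENNReal.ofReal (C * 2 ^ (-(lam * j))) *
          law Ω δ u v {γ | outEdgeSet γ c (4 * N) = outEdgeSet γ₀ c (4 * N)}

/-- **The free form implies `HeavinessContraction`** (take `θ = 0`). [folklore] -/
theorem heavinessContraction_of_free : HeavinessContractionFree → HeavinessContraction := by
  intro h
  obtain ⟨lam, C, m₀, hlam, H⟩ := h
  refine ⟨0, lam, C, m₀, by norm_num, hlam, ?_⟩
  intro Ω δ u v c N m j γ₀ hΩ hδ hN hbox _ hj
  exact H Ω δ u v c N j γ₀ hΩ hδ hN hbox (by simpa using hj)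

/-- **The free form implies `CleanContraction`** (through `HeavinessContraction`). [folklore] -/
theorem cleanContraction_of_free : HeavinessContractionFree → CleanContraction :=
  fun h => cleanContraction_of_heavinessContraction (heavinessContraction_of_free h)

/-- **A clean kernel inequality with slope `θ ≤ 0` is already the free form** — hence it removes
decorations at no cost: instantiate the hypothesis "at most `m` pieces in total" with the a-priori
bound `m = |γ₀| + 1` (`HasPieces.le_length_succ`), which every outside configuration satisfies, and
use `θ m ≤ 0`. So the decoration-removal step is non-trivial only in so far as the clean contraction
genuinely needs a threshold growing with the number of conditioned pieces. [folklore] -/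
theorem heavinessContractionFree_of_clean_nonpos
    (h : ∃ (θ lam C : ℝ) (m₀ : ℕ), θ ≤ 0 ∧ 0 < lam ∧
      ∀ (Ω : Set ℂ) (δ : ℝ) (u v c : Site 2) (N m j : ℕ) (γ₀ : DomainSAW Ω δ u v),
        Bornology.IsBounded Ω → 0 < δ → 1 ≤ N → closedBox δ c (4 * N) ⊆ Ω →
        ¬ HasPieces γ₀ c (4 * N) 0 (m + 1) → θ * m + m₀ ≤ (j : ℝ) →
        law Ω δ u v {γ | outEdgeSet γ c (4 * N) = outEdgeSet γ₀ c (4 * N) ∧ HasPieces γ c N N j}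
          ≤ ENNReal.ofReal (C * 2 ^ (-(lam * j))) *
            law Ω δ u v {γ | outEdgeSet γ c (4 * N) = outEdgeSet γ₀ c (4 * N)}) :
    HeavinessContractionFree := by
  obtain ⟨θ, lam, C, m₀, hθ, hlam, H⟩ := h
  refine ⟨lam, C, m₀, hlam, ?_⟩
  intro Ω δ u v c N j γ₀ hΩ hδ hN hbox hj
  have hm : ¬ HasPieces γ₀ c (4 * N) 0 (γ₀.walk.length + 1 + 1) := fun h' => by
    have := h'.le_length_succ
    omega
  refine H Ω δ u v c N (γ₀.walk.length + 1) j γ₀ hΩ hδ hN hbox hm ?_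
  have h0 : (0 : ℝ) ≤ ((γ₀.walk.length + 1 : ℕ) : ℝ) := Nat.cast_nonneg _
  have : θ * ((γ₀.walk.length + 1 : ℕ) : ℝ) ≤ 0 := mul_nonpos_of_nonpos_of_nonneg hθ h0
  linarith

/-- Conversely the free form is a clean kernel inequality with slope `0` (so the two previous
theorems lose nothing). [folklore] -/
theorem clean_nonpos_of_heavinessContractionFree (h : HeavinessContractionFree) :
    ∃ (θ lam C : ℝ) (m₀ : ℕ), θ ≤ 0 ∧ 0 < lam ∧
      ∀ (Ω : Set ℂ) (δ : ℝ) (u v c : Site 2) (N m j : ℕ) (γ₀ : DomainSAW Ω δ u v),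
        Bornology.IsBounded Ω → 0 < δ → 1 ≤ N → closedBox δ c (4 * N) ⊆ Ω →
        ¬ HasPieces γ₀ c (4 * N) 0 (m + 1) → θ * m + m₀ ≤ (j : ℝ) →
        law Ω δ u v {γ | outEdgeSet γ c (4 * N) = outEdgeSet γ₀ c (4 * N) ∧ HasPieces γ c N N j}
          ≤ ENNReal.ofReal (C * 2 ^ (-(lam * j))) *
            law Ω δ u v {γ | outEdgeSet γ c (4 * N) = outEdgeSet γ₀ c (4 * N)} := by
  obtain ⟨lam, C, m₀, hlam, H⟩ := h
  refine ⟨0, lam, C, m₀, le_rfl, hlam, ?_⟩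
  intro Ω δ u v c N m j γ₀ hΩ hδ hN hbox _ hj
  exact H Ω δ u v c N j γ₀ hΩ hδ hN hbox (by simpa using hj)

/-! ## The residual of the free form -/

/-- **Residual threshold-free contraction**: `HeavinessContractionFree` in the non-trivial regime
only (`N ≥ N₀`, `N ≥ 2`, `u ≠ v`, `m₀ ≤ j ≤ min((2N-1)² + 1, 8N + 1)`). The strongest and
simplest target a future prover of the engine may aim at: it implies every contraction statement
of the line (`heavinessContractionFree_of_freeCore`, `heavinessContraction_of_free`,
`cleanContraction_of_free`). Nothing is asserted here. -/
def HeavinessContractionFreeCore : Prop :=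
  ∃ (N₀ : ℕ) (lam C : ℝ) (m₀ : ℕ), 0 < lam ∧
    ∀ (Ω : Set ℂ) (δ : ℝ) (u v c : Site 2) (N j : ℕ) (γ₀ : DomainSAW Ω δ u v),
      Bornology.IsBounded Ω → 0 < δ → N₀ ≤ N → 2 ≤ N → closedBox δ c (4 * N) ⊆ Ω → u ≠ v →
      (m₀ : ℝ) ≤ j → j ≤ (2 * N - 1) ^ 2 + 1 → j ≤ 8 * N + 1 →
      law Ω δ u v {γ | outEdgeSet γ c (4 * N) = outEdgeSet γ₀ c (4 * N) ∧ HasPieces γ c N N j}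
        ≤ ENNReal.ofReal (C * 2 ^ (-(lam * j))) *
          law Ω δ u v {γ | outEdgeSet γ c (4 * N) = outEdgeSet γ₀ c (4 * N)}

/-- **Reduction for the free form** (`m₀ ↦ max m₀ (8N₀ + 3)`; the trivial regimes are empty events
as in `heavinessContraction_of_core`; proof adapted from `cleanContraction_of_core`). [folklore] -/
theorem heavinessContractionFree_of_freeCore :
    HeavinessContractionFreeCore → HeavinessContractionFree := by
  -- adapted from cleanContraction_of_core (…CleanContractionAux, same line)
  intro h
  obtain ⟨N₀, lam, C, m₀, hlam, H⟩ := h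
  refine ⟨lam, C, max m₀ (8 * N₀ + 3), hlam, ?_⟩
  intro Ω δ u v c N j γ₀ hΩ hδ hN hbox hj
  have hm₀' : ((8 * N₀ + 3 : ℕ) : ℝ) ≤ ((max m₀ (8 * N₀ + 3) : ℕ) : ℝ) := by
    exact_mod_cast le_max_right m₀ _
  have hm₀ : (m₀ : ℝ) ≤ ((max m₀ (8 * N₀ + 3) : ℕ) : ℝ) := by exact_mod_cast le_max_left m₀ _
  have hjN₀ : 8 * N₀ + 3 ≤ j := by
    have : ((8 * N₀ + 3 : ℕ) : ℝ) ≤ j := by linarith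
    exact_mod_cast this
  have hjm₀ : (m₀ : ℝ) ≤ j := by linarith
  by_cases hjN : (2 * N - 1) ^ 2 + 1 < j
  · rw [law_sep_hasPieces_eq_zero _ hjN]
    exact zero_le
  push Not at hjN
  by_cases hjN' : 8 * N + 1 < j
  · rw [law_sep_hasPieces_eq_zero' _ hjN']
    exact zero_le
  push Not at hjN'
  by_cases huv : u = v
  · subst huv
    rw [law_sep_hasPieces_eq_zero_of_loop _ (by omega)]
    exact zero_le
  have hNN₀ : N₀ ≤ N := by omega
  have hN2 : 2 ≤ N := by
    by_contra hlt
    interval_cases N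
    all_goals (norm_num at hjN; omega)
  exact H Ω δ u v c N j γ₀ hΩ hδ hNN₀ hN2 hbox huv hjm₀ hjN hjN'

/-- **The free residual implies the decorated residual** (slope `0`, and the hypotheses `m ≤ 2j`,
"at most `m` big pieces" are simply dropped). [folklore] -/
theorem heavinessContractionCore_of_freeCore :
    HeavinessContractionFreeCore → HeavinessContractionCore := by
  intro h
  obtain ⟨N₀, lam, C, m₀, hlam, H⟩ := h
  refine ⟨N₀, 0, lam, C, m₀, by norm_num, hlam, ?_⟩
  intro Ω δ u v c N m j γ₀ hΩ hδ hN₀ hN hbox huv _ hj hj1 hj2 _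
  exact H Ω δ u v c N j γ₀ hΩ hδ hN₀ hN hbox huv (by simpa using hj) hj1 hj2

/-! ## What the clean kernel does give on decorated data: an `s`-dependent threshold -/

/-- **`CleanContraction` removes BOUNDEDLY MANY decorations.** For every number `s` of decorations
there are constants `θ < 1`, `λ₀ > 0`, `C`, `m₀ + s` such that the contraction inequality holds for
outside data with at most `m` big pieces and at most `m + s` pieces in total
(`θ (m + s) + m₀ ≤ θ m + (m₀ + s)` as `θ < 1`). `HeavinessContraction` is exactly this statement with
constants UNIFORM in `s` (the second hypothesis is then void, `s ≤ 32N + 1` being automatic by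
`not_hasPieces_outer`): the whole content of the decoration-removal stub is the uniformity of the
threshold in the number `s ≍ N` of decorations. [folklore] -/
theorem heavinessContraction_bdd_of_clean (h : CleanContraction) (s : ℕ) :
    ∃ (θ lam C : ℝ) (m₀ : ℕ), θ < 1 ∧ 0 < lam ∧
      ∀ (Ω : Set ℂ) (δ : ℝ) (u v c : Site 2) (N m j : ℕ) (γ₀ : DomainSAW Ω δ u v),
        Bornology.IsBounded Ω → 0 < δ → 1 ≤ N → closedBox δ c (4 * N) ⊆ Ω →
        ¬ HasPieces γ₀ c (4 * N) (4 * N) (m + 1) → ¬ HasPieces γ₀ c (4 * N) 0 (m + s + 1) →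
        θ * m + m₀ ≤ (j : ℝ) →
        law Ω δ u v {γ | outEdgeSet γ c (4 * N) = outEdgeSet γ₀ c (4 * N) ∧ HasPieces γ c N N j}
          ≤ ENNReal.ofReal (C * 2 ^ (-(lam * j))) *
            law Ω δ u v {γ | outEdgeSet γ c (4 * N) = outEdgeSet γ₀ c (4 * N)} := by
  obtain ⟨θ, lam, C, m₀, hθ, hlam, H⟩ := h
  refine ⟨θ, lam, C, m₀ + s, hθ, hlam, ?_⟩
  intro Ω δ u v c N m j γ₀ hΩ hδ hN hbox _ hms hj
  refine H Ω δ u v c N (m + s) j γ₀ hΩ hδ hN hbox hms ?_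
  have hs : (0 : ℝ) ≤ s := Nat.cast_nonneg _
  have h1 : θ * s ≤ s := by nlinarith
  push_cast at hj ⊢
  nlinarith

end Summit.CriticalPhenomena.SAWScalingLimit.Theorems.TPToTraversalBound.Radial

end
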